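import Literature.NumberTheory.ConnesConsani2023.ZetaCyclesCoreTruncation
import Literature.NumberTheory.LFunctions.WeilExplicitContinuous
import Literature.NumberTheory.LFunctions.Weil1952CriterionProofs
import HarnessLib

/-!
# ζ-cycles, §2.1.2, Lemma 2.2 — step (2.18): mollification in the energy norm

RH-FREE (label, line 1).  Fifth proof file of
`Literature/NumberTheory/ConnesConsani2023/ZetaCyclesSemilocalForm.lean` (Connes–Consani, *Spectral
triples and ζ-cycles*, Enseign. Math. **69** (2023), proof of Lemma 2.2, p. 105
[cite: ConnesConsani2023, Lemma 2.2 eq. (2.18) p. 105]).  Step (2.18) of the printed proof: for `ξ₁`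
in the form domain and supported in a window `[−a', a']` STRICTLY inside `[−a, a]`, the mollifications
`η_n = φ_n ⋆ ξ₁` (`φ_n(x) = nφ(nx)`, `φ ∈ C_c^∞` positive of integral one) are smooth, supported inside
`(−a, a)` for `n` large, `η̂_n(s) = φ̂(s/n) ξ̂₁(s)` with `|φ̂(s/n)| ≤ 1 → 1`, so that
`‖(ξ₁ − η_n)^‖₁² → 0` by dominated convergence.  In the tree's vocabulary (`moll k` = the normalised
bump of radius `1/(k+1)` of `WeilExplicitContinuous.lean`, `weilConv` = additive convolution):

* `weilConv_moll_mem_C`: `ξ ⋆ φ_k ∈ C(a)` (smooth, `tsupport ⊆ [−a, a]`) once `1/(k+1) ≤ a − a'`;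
* `tendsto_logSobolevEnergy_sub_weilConv_moll`: `‖(ξ − ξ ⋆ φ_k)^‖₁² → 0` for `ξ ∈ Dom(QW_λ)`;
* `exists_mem_W_energy_sub_lt_of_support_subset`: steps (2.18)+(2.19) together — every `ξ ∈ Dom(QW_λ)`
  supported in `[−a', a']`, `a' < a`, is within any `ε > 0` in energy of a Laurent polynomial
  `η ∈ W a N` (using `tendsto_logSobolevEnergy_sub_proj` of `ZetaCyclesCoreTruncation.lean` and
  `C(a) ⊆ K(a)`).

What then remains of Lemma 2.2 is step (2.17) alone (dilation `ξ ↦ ρξ(ρx)` is continuous in the graph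
norm), which removes the hypothesis `a' < a`.  Theorems only; no definition, no named fact.
Nothing here bears on the truth of the Riemann hypothesis.
-/

noncomputable section

open Complex Filter Set MeasureTheory
open scoped Real Topology ENNReal ComplexConjugate

namespace Literature.NumberTheory.ConnesConsani2023

open Literature.NumberTheory.LFunctions
open Literature.NumberTheory.LFunctions.WeilContinuous

variable {a : ℝ}

/-! ## §1 The mollified window function is a test function supported near the window -/

/-- A function supported in a compact interval has compact support. [cite: ConnesConsani2023, proof of Lemma 2.2 (supp ξ₁ ⊂ [−ρ⁻¹L/2, ρ⁻¹L/2]; arXiv chunk p0007:L46), p. 105] -/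
theorem hasCompactSupport_of_support_subset_Icc {ξ : ℝ → ℂ} {b c : ℝ}
    (h : Function.support ξ ⊆ Icc b c) : HasCompactSupport ξ :=
  isCompact_Icc.of_isClosed_subset isClosed_closure (closure_minimal h isClosed_Icc)

/-- **Support of the mollification**: if `ξ` vanishes for `|u| > R` then `ξ ⋆ φ_k` vanishes for
`|x| > R + 1/(k+1)`. [cite: ConnesConsani2023, proof of Lemma 2.2 («the convolution ξ₂ = φ ⋆ ξ₁ … is a smooth function with support in the interior of the interval»; arXiv chunk p0007:L46–L48), p. 105] -/
theorem weilConv_moll_eq_zero_of_lt {ξ : ℝ → ℂ} {R : ℝ} (hξ : ∀ u, R < |u| → ξ u = 0) {k : ℕ}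
    {x : ℝ} (hx : R + 1 / ((k : ℝ) + 1) < |x|) : weilConv ξ (moll k) x = 0 := by
  rw [weilConv_apply]
  refine integral_eq_zero_of_ae (Eventually.of_forall fun u ↦ ?_)
  simp only [Pi.zero_apply]
  rcases le_or_gt (bump k).rOut |x - u| with hu | hu
  · rw [moll_eq_zero hu, mul_zero]
  · rw [bump_rOut] at hu
    have h2 : R < |u| := by
      have := abs_sub_abs_le_abs_sub x u
      linarith
    rw [hξ u h2, zero_mul]

/-- The mollification of an integrable compactly supported function is a test function (smooth with
compact support: Mathlib `HasCompactSupport.contDiff_convolution_right`). [cite: ConnesConsani2023, proof of Lemma 2.2 (ξ₂ = φ ⋆ ξ₁ is smooth; arXiv chunk p0007:L46–L48), p. 105] -/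
theorem isWeilTest_weilConv_moll_of_integrable {ξ : ℝ → ℂ} (h1 : Integrable ξ)
    (hs : HasCompactSupport ξ) (k : ℕ) : IsWeilTest (weilConv ξ (moll k)) := by
  rw [weilConv_eq_convolution_real]
  exact ⟨(hasCompactSupport_moll k).contDiff_convolution_right (ContinuousLinearMap.mul ℝ ℂ)
      h1.locallyIntegrable (contDiff_moll k),
    HasCompactSupport.convolution (L := ContinuousLinearMap.mul ℝ ℂ) hs (hasCompactSupport_moll k)⟩

/-- A window function supported in `[−a', a']` vanishes for `|u| > a'`. [cite: ConnesConsani2023, proof of Lemma 2.2 (supp ξ₁ ⊂ [−ρ⁻¹L/2, ρ⁻¹L/2]; arXiv chunk p0007:L46), p. 105] -/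
theorem eq_zero_of_support_subset_of_lt {ξ : ℝ → ℂ} {a' : ℝ}
    (hξs : Function.support ξ ⊆ Icc (-a') a') {u : ℝ} (hu : a' < |u|) : ξ u = 0 := by
  by_contra hne
  have h := hξs (Function.mem_support.2 hne)
  rw [mem_Icc, ← abs_le] at h
  linarith

/-- **`ξ ⋆ φ_k ∈ C(a)` for `k` large**: if `ξ ∈ L¹` is supported in `[−a', a']` and
`1/(k+1) ≤ a − a'`, the mollification is a test function with `tsupport ⊆ [−a, a]`.
[cite: ConnesConsani2023, proof of Lemma 2.2 («η_n ∈ C_c^∞((−L/2, L/2))»; arXiv chunk p0007:L46–L50), p. 105] -/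
theorem weilConv_moll_mem_C {ξ : ℝ → ℂ} {a' : ℝ} (h1 : Integrable ξ)
    (hξs : Function.support ξ ⊆ Icc (-a') a') {k : ℕ} (hk : 1 / ((k : ℝ) + 1) ≤ a - a') :
    weilConv ξ (moll k) ∈ Yoshida1992.C a := by
  rw [Yoshida1992.mem_C]
  refine ⟨isWeilTest_weilConv_moll_of_integrable h1 (hasCompactSupport_of_support_subset_Icc hξs) k,
    closure_minimal (fun x hx ↦ ?_) isClosed_Icc⟩
  by_contra hxa
  have hxa' : a < |x| := by
    rw [mem_Icc, ← abs_le, not_le] at hxa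
    exact hxa
  exact hx (weilConv_moll_eq_zero_of_lt (R := a')
    (fun u hu ↦ eq_zero_of_support_subset_of_lt hξs hu) (by linarith))

/-! ## §2 Dominated convergence: `‖(ξ − ξ ⋆ φ_k)^‖₁² → 0` on the form domain -/

/-- `φ_k` is integrable. [cite: ConnesConsani2023, proof of Lemma 2.2 (φ ∈ C_c^∞ positive with integral 1; arXiv chunk p0007:L48), p. 105] -/
private theorem integrable_moll (k : ℕ) : Integrable (moll k) :=
  (continuous_moll k).integrable_of_hasCompactSupport (hasCompactSupport_moll k)

/-- The transform of `ξ − ξ ⋆ φ_k` on the critical line is `ξ̂ (1 − φ̂_k)`. [cite: ConnesConsani2023, proof of Lemma 2.2 («η̂_n(s) = φ̂(s/n) ξ̂₁(s)»; arXiv chunk p0007:L48–L49), p. 105] -/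
theorem weilMellin_sub_weilConv_moll {ξ : ℝ → ℂ} (hξ : MemLp ξ 2 volume)
    (hξs : Function.support ξ ⊆ Icc (-a) a) (k : ℕ) (t : ℝ) :
    weilMellin (fun x ↦ ξ x - weilConv ξ (moll k) x) (1 / 2 + t * I) =
      weilMellin ξ (1 / 2 + t * I) * (1 - weilMellin (moll k) (1 / 2 + t * I)) := by
  have h1 : Integrable ξ := integrable_of_memLp_window hξ hξs
  have hη := isWeilTest_weilConv_moll_of_integrable h1 (hasCompactSupport_of_support_subset_Icc hξs) k
  have hi1 := integrable_mul_cexp_window hξ hξs (1 / 2 + t * I - 1 / 2)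
  have hi2 : Integrable fun x : ℝ ↦ weilConv ξ (moll k) x * cexp ((1 / 2 + t * I - 1 / 2) * x) :=
    (hη.1.continuous.mul (by fun_prop)).integrable_of_hasCompactSupport hη.2.mul_right
  have hsub : weilMellin (fun x ↦ ξ x - weilConv ξ (moll k) x) (1 / 2 + t * I) =
      weilMellin ξ (1 / 2 + t * I) - weilMellin (weilConv ξ (moll k)) (1 / 2 + t * I) := by
    unfold weilMellin
    rw [← integral_sub hi1 hi2]
    congr 1 with x
    ring
  rw [hsub, Weil1952.weilMellin_weilConv_of_integrable h1 (integrable_moll k) (by simp)]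
  ring

/-- **Step (2.18), dominated convergence**: for `ξ ∈ Dom(QW_λ)`, `‖(ξ − ξ ⋆ φ_k)^‖₁² → 0`
(`|φ̂_k| ≤ 1` on the critical line and `φ̂_k → 1` pointwise; majorant `4|ξ̂|²(1+log(1+t²))`).
[cite: ConnesConsani2023, proof of Lemma 2.2 eq. (2.18) («the Lebesgue dominated convergence theorem shows that for n large enough …»; arXiv chunk p0007:L48–L50), p. 105] -/
theorem tendsto_logSobolevEnergy_sub_weilConv_moll {ξ : ℝ → ℂ} (hξ : ξ ∈ formDomain a) :
    Tendsto (fun k ↦ logSobolevEnergy (fun x ↦ ξ x - weilConv ξ (moll k) x)) atTop (𝓝 0) := by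
  have h1 : Integrable ξ := integrable_of_memLp_window hξ.1 hξ.2.1
  have hξc := hasCompactSupport_of_support_subset_Icc hξ.2.1
  have hη := fun k ↦ isWeilTest_weilConv_moll_of_integrable h1 hξc k
  set w : ℝ → ℝ := fun t ↦ 1 + Real.log (1 + t ^ 2) with hw_def
  have hw0 : ∀ t, 0 ≤ w t := fun t ↦ by
    have := Real.log_nonneg (show (1 : ℝ) ≤ 1 + t ^ 2 by nlinarith [sq_nonneg t])
    simp only [hw_def]
    linarith
  set F : ℕ → ℝ → ℝ≥0∞ := fun k t ↦ ENNReal.ofReal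
    (‖weilMellin (fun x ↦ ξ x - weilConv ξ (moll k) x) (1 / 2 + t * I)‖ ^ 2 * w t) with hF_def
  set bound : ℝ → ℝ≥0∞ := fun t ↦ ENNReal.ofReal 4 *
    ENNReal.ofReal (‖weilMellin ξ (1 / 2 + t * I)‖ ^ 2 * w t) with hbound_def
  have hmeas : ∀ k, Measurable (F k) := fun k ↦
    measurable_energyIntegrand (h1.sub ((hη k).1.continuous.integrable_of_hasCompactSupport (hη k).2))
  have hbd : ∀ k, ∀ᵐ t ∂(volume : Measure ℝ), F k t ≤ bound t := by
    intro k
    refine Eventually.of_forall fun t ↦ ?_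
    simp only [hF_def, hbound_def]
    rw [← ENNReal.ofReal_mul (by norm_num), weilMellin_sub_weilConv_moll hξ.1 hξ.2.1 k t, norm_mul,
      mul_pow]
    refine ENNReal.ofReal_le_ofReal ?_
    have hm : ‖1 - weilMellin (moll k) (1 / 2 + t * I)‖ ≤ 2 := by
      calc ‖1 - weilMellin (moll k) (1 / 2 + t * I)‖ ≤ ‖(1 : ℂ)‖ + ‖weilMellin (moll k) (1 / 2 + t * I)‖ :=
            norm_sub_le _ _
        _ ≤ 1 + 1 := by rw [norm_one]; linarith [norm_weilMellin_moll_half_le k t]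
        _ = 2 := by norm_num
    have hm2 : ‖1 - weilMellin (moll k) (1 / 2 + t * I)‖ ^ 2 ≤ 4 := by
      nlinarith [norm_nonneg (1 - weilMellin (moll k) (1 / 2 + t * I))]
    have hx := sq_nonneg ‖weilMellin ξ (1 / 2 + t * I)‖
    have hwt := hw0 t
    calc ‖weilMellin ξ (1 / 2 + t * I)‖ ^ 2 * ‖1 - weilMellin (moll k) (1 / 2 + t * I)‖ ^ 2 * w t
        ≤ ‖weilMellin ξ (1 / 2 + t * I)‖ ^ 2 * 4 * w t := by gcongr
      _ = 4 * (‖weilMellin ξ (1 / 2 + t * I)‖ ^ 2 * w t) := by ring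
  have hfin : ∫⁻ t, bound t ≠ ∞ := by
    simp only [hbound_def]
    rw [lintegral_const_mul' _ _ ENNReal.ofReal_ne_top]
    exact ENNReal.mul_ne_top ENNReal.ofReal_ne_top (by
      have := hξ.2.2; unfold logSobolevEnergy at this; exact this.ne)
  have hlim : ∀ᵐ t ∂(volume : Measure ℝ), Tendsto (fun k ↦ F k t) atTop (𝓝 0) := by
    refine Eventually.of_forall fun t ↦ ?_
    simp only [hF_def]
    have h0 : Tendsto (fun k ↦ ‖weilMellin ξ (1 / 2 + t * I) *
        (1 - weilMellin (moll k) (1 / 2 + t * I))‖ ^ 2 * w t) atTop (𝓝 0) := by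
      have hm := tendsto_weilMellin_moll (1 / 2 + t * I)
      have h := ((tendsto_const_nhds (x := weilMellin ξ (1 / 2 + t * I))).mul
        ((tendsto_const_nhds (x := (1 : ℂ))).sub hm)).norm.pow 2 |>.mul_const (w t)
      simpa using h
    have h2 := ENNReal.tendsto_ofReal h0
    rw [ENNReal.ofReal_zero] at h2
    refine h2.congr fun k ↦ ?_
    rw [weilMellin_sub_weilConv_moll hξ.1 hξ.2.1 k t]
  have h := tendsto_lintegral_of_dominated_convergence bound hmeas hbd hfin hlim
  rw [lintegral_zero] at h
  exact h

/-! ## §3 Steps (2.18)+(2.19): Laurent approximation in energy inside a strictly smaller window -/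

/-- `‖(f + g)^‖₁² ≤ 2‖f̂‖₁² + 2‖ĝ‖₁²` for window functions. [cite: ConnesConsani2023, proof of Lemma 2.2 (the weighted norm ‖·‖₁ is a Hilbert seminorm, ε/2 + ε/4 + ε/4 bookkeeping; arXiv chunk p0007:L10–L60), p. 104–105] -/
theorem logSobolevEnergy_add_le {f g : ℝ → ℂ} (hf : MemLp f 2 volume)
    (hfs : Function.support f ⊆ Icc (-a) a) (hg : MemLp g 2 volume)
    (hgs : Function.support g ⊆ Icc (-a) a) :
    logSobolevEnergy (fun x ↦ f x + g x) ≤ 2 * logSobolevEnergy f + 2 * logSobolevEnergy g := by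
  have hf1 := integrable_of_memLp_window hf hfs
  have hmeas : AEMeasurable (fun s : ℝ ↦ 2 * ENNReal.ofReal
      (‖weilMellin f (1 / 2 + s * I)‖ ^ 2 * (1 + Real.log (1 + s ^ 2)))) volume :=
    ((measurable_energyIntegrand hf1).const_mul _).aemeasurable
  unfold logSobolevEnergy
  rw [← lintegral_const_mul' _ _ (by norm_num), ← lintegral_const_mul' _ _ (by norm_num),
    ← lintegral_add_left' hmeas]
  refine lintegral_mono fun s ↦ ?_
  have hw : 0 ≤ 1 + Real.log (1 + s ^ 2) := by
    have := Real.log_nonneg (show (1 : ℝ) ≤ 1 + s ^ 2 by nlinarith [sq_nonneg s])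
    linarith
  rw [weilMellin_add_window hf hfs hg hgs, show (2 : ℝ≥0∞) = ENNReal.ofReal 2 by norm_num,
    ← ENNReal.ofReal_mul zero_le_two, ← ENNReal.ofReal_mul zero_le_two,
    ← ENNReal.ofReal_add (by positivity) (by positivity)]
  refine ENNReal.ofReal_le_ofReal ?_
  set x := weilMellin f (1 / 2 + s * I)
  set y := weilMellin g (1 / 2 + s * I)
  have h1 : ‖x + y‖ ≤ ‖x‖ + ‖y‖ := norm_add_le x y
  have h2 : ‖x + y‖ ^ 2 ≤ 2 * ‖x‖ ^ 2 + 2 * ‖y‖ ^ 2 := by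
    nlinarith [norm_nonneg (x + y), norm_nonneg x, norm_nonneg y, sq_nonneg (‖x‖ - ‖y‖)]
  nlinarith

/-- **Steps (2.18) and (2.19) of the proof of Lemma 2.2 combined** (PROVED): every `ξ ∈ Dom(QW_λ)`
supported in a strictly smaller window `[−a', a']`, `a' < a`, is within any `ε > 0` in the energy
norm of a Laurent polynomial `η ∈ W a N = E_N`: mollify (`ξ ⋆ φ_k ∈ C(a) ⊆ K(a)`, energy-close by
dominated convergence), then truncate the Fourier series (`tendsto_logSobolevEnergy_sub_proj`).  The
remaining step (2.17) of the printed proof (dilation) removes the hypothesis `a' < a`.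
[cite: ConnesConsani2023, proof of Lemma 2.2, eqs. (2.18)–(2.19) (arXiv chunk p0007:L46–L60), p. 105] -/
theorem exists_mem_W_energy_sub_lt_of_support_subset (ha : 0 < a) {a' : ℝ} (ha' : a' < a)
    {ξ : ℝ → ℂ} (hξ : ξ ∈ formDomain a) (hξs : Function.support ξ ⊆ Icc (-a') a')
    {ε : ℝ} (hε : 0 < ε) :
    ∃ N : ℕ, ∃ η ∈ Yoshida1992.W a N, logSobolevEnergy (ξ - η) < ENNReal.ofReal ε := by
  have h1 : Integrable ξ := integrable_of_memLp_window hξ.1 hξ.2.1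
  -- Step (2.18): a mollification in `C(a)` within `ε/4`
  have hE := tendsto_logSobolevEnergy_sub_weilConv_moll hξ
  have hev1 : ∀ᶠ k : ℕ in atTop, logSobolevEnergy (fun x ↦ ξ x - weilConv ξ (moll k) x) <
      ENNReal.ofReal (ε / 4) :=
    hE.eventually (gt_mem_nhds (ENNReal.ofReal_pos.2 (by positivity)))
  have hev2 : ∀ᶠ k : ℕ in atTop, 1 / ((k : ℝ) + 1) ≤ a - a' := by
    have ht : Tendsto (fun k : ℕ ↦ 1 / ((k : ℝ) + 1)) atTop (𝓝 0) :=
      tendsto_one_div_add_atTop_nhds_zero_nat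
    exact (ht.eventually (gt_mem_nhds (by linarith : (0 : ℝ) < a - a'))).mono fun k hk ↦ hk.le
  obtain ⟨k, hk1, hk2⟩ := (hev1.and hev2).exists
  set ζ : ℝ → ℂ := weilConv ξ (moll k) with hζ_def
  have hζC : ζ ∈ Yoshida1992.C a := weilConv_moll_mem_C h1 hξs hk2
  have hζK : ζ ∈ Yoshida1992.K a := Yoshida1992.C_le_K ha hζC
  have hζ2 := memLp_and_support_of_mem_K hζK
  -- Step (2.19): a truncation within `ε/4`
  have hT := tendsto_logSobolevEnergy_sub_proj ha hζK
  obtain ⟨N, hN⟩ := (hT.eventually (gt_mem_nhds (ENNReal.ofReal_pos.2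
    (by positivity : (0 : ℝ) < ε / 4)))).exists
  refine ⟨N, Yoshida1992.proj a N ζ, Yoshida1992.proj_mem_W a N ζ, ?_⟩
  have hP := mem_formDomain_of_mem_W ha (Yoshida1992.proj_mem_W a N ζ)
  -- `ξ − P = (ξ − ζ) + (ζ − P)`
  have e : ξ - Yoshida1992.proj a N ζ =
      fun x ↦ (ξ x - ζ x) + (ζ x - Yoshida1992.proj a N ζ x) := by
    funext x
    simp only [Pi.sub_apply]
    ring
  rw [e]
  have hd1 : MemLp (fun x ↦ ξ x - ζ x) 2 volume ∧ Function.support (fun x ↦ ξ x - ζ x) ⊆ Icc (-a) a :=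
    ⟨hξ.1.sub hζ2.1, support_sub_subset_window hξ.2.1 hζ2.2⟩
  have hd2 : MemLp (fun x ↦ ζ x - Yoshida1992.proj a N ζ x) 2 volume ∧
      Function.support (fun x ↦ ζ x - Yoshida1992.proj a N ζ x) ⊆ Icc (-a) a :=
    ⟨hζ2.1.sub hP.1, support_sub_subset_window hζ2.2 hP.2.1⟩
  refine (logSobolevEnergy_add_le hd1.1 hd1.2 hd2.1 hd2.2).trans_lt ?_
  have h4 : ENNReal.ofReal (ε / 4) ≠ ⊤ := ENNReal.ofReal_ne_top
  calc 2 * logSobolevEnergy (fun x ↦ ξ x - ζ x) +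
        2 * logSobolevEnergy (fun x ↦ ζ x - Yoshida1992.proj a N ζ x)
      = logSobolevEnergy (fun x ↦ ξ x - ζ x) * 2 +
        logSobolevEnergy (fun x ↦ ζ x - Yoshida1992.proj a N ζ x) * 2 := by ring
    _ < ENNReal.ofReal (ε / 4) * 2 + ENNReal.ofReal (ε / 4) * 2 := by
        refine ENNReal.add_lt_add ?_ ?_
        · exact ENNReal.mul_lt_mul_left (by norm_num) (by norm_num) hk1
        · exact ENNReal.mul_lt_mul_left (by norm_num) (by norm_num) hN
    _ = ENNReal.ofReal ε := by
        rw [← mul_add, show (2 : ℝ≥0∞) + 2 = ENNReal.ofReal 4 by rw [ENNReal.ofReal_ofNat]; norm_num,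
          ← ENNReal.ofReal_mul (by positivity)]
        congr 1
        ring

end Literature.NumberTheory.ConnesConsani2023

end
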